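import Summits.CriticalPhenomena.PercolationContinuityZ3.Theorems.Transplant.SkelPhiRunExitGoals
import Summits.CriticalPhenomena.PercolationContinuityZ3.Theorems.Transplant.SkelPhiRunKitClause
import Summits.CriticalPhenomena.PercolationContinuityZ3.Theorems.Transplant.SkelPhiParaRouteN
import Summits.CriticalPhenomena.PercolationContinuityZ3.Theorems.Transplant.SkelPhiStepINegOrient
import HarnessLib

/-!
# N1 (the `{±1}` node), LEVEL 1, kit adapter file N-K8f: **THE ORIENTATION-AWARE, CASE-SPLIT EXIT PIECE TABLE OF A RUN-LEVEL KIT** — the short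
# piece data at a centre `c` carry their own orientation (`oS c = true`: the run's chart `φ`; `false`: `trφ φ`; stmt-g14 (L3)), and per side the
# piece is chosen by the slope regime (stmt-g14 (L2)): RAW sides — same: x side half; transposed: x side half if `|h_s| ≥ M_z+3`, else top piece;
# LEVEL sides — same: x side half if `|n_L h_s − h_L n_s| ≥ A + n_L`, else top piece; transposed: x side half if `|n_L n_s − h_L h_s| ≥ A + n_L`,
# else top piece (sign `−e·sgnz h_L`). Under the ledger floors `n_s ≥ 22M_z+58`, `ℓ_s ≥ 24M_z+64`, `|h_s| ≤ 10n_s`, `|h_L| ≤ 10n_L`,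
# `A = (M_z+1)U_L + 1` every entry lies below its side's shell line: the `hPex` hypothesis of `kitClause_runXG/YG(Hab)` / `hkits_runXG/YG(Hab)`

builds on p205010 (kernel theorem, internal audit signed; external expert review pending) — nothing in this file uses p205010; nothing here is a
claim about the open node `SamePDropOfSkeletonNeg`.
Lane `prim-bschramm`, seat `prim-bschramm-p1` (gen 11; design KIT-APRON-N1); helper file (`--supports stmt-CriticalPhenomena-4575 --as helper`).
* `ShortPcO` (`ShortPc` + orientation flag), `RgO` (the short prism in its orientation), `pexXO` / `pexYO` (the tables), `pexXO_subset` /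
  `pexYO_subset`, **`pexXO_spec`**, **`pexYO_spec`**.
[cite: MartineauTassion2017, §3.2] [cite: KozmaNitzan2024, §4 p. 20 (Step IV)]
-/

noncomputable section

open scoped Classical

namespace Summit.CriticalPhenomena.PercolationContinuityZ3.Theorems.Transplant

namespace Skelφ

open Literature.Probability.Percolation Literature.Probability.LatticeModels SimpleGraph
open Literature.Probability.Percolation.KozmaNitzan.Cells (oth oth_ne eq_oth_of_ne oth_oth)
open Literature.Barriers.CriticalPhenomena (graphBall graphBall_mono)

variable {V : Type} {G : SimpleGraph V} [G.LocallyFinite] {φ : V → Site 2}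

/-- **Short piece data with orientation**: width, shear, half-length, prism radius, split point, and the orientation flag of the kit pair at the
centre (`true` = the run's chart). [cite: MartineauTassion2017, §3.2] -/
structure ShortPcO (V : Type) extends ShortPc V where
  /-- orientation of the kit pair at the centre (`true`: `φ`, `false`: `trφ φ`) -/
  oS : V → Bool

variable (G φ) in
/-- The short prism at `c` in its own orientation. -/
def RgO (Q : ShortPcO V) (c : V) : Finset V := pgramPrismFin G (oriφ φ (Q.oS c)) c (Q.nS c) (Q.hS c) (3 * Q.ℓS c) (Q.RS c)

variable (G φ) in
/-- The piece of the raw-side exit at `c` (`e = σ₀σ`). -/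
def pexRaw (Q : ShortPcO V) (Mz : ℕ) (e : ℤ) (c : V) : Finset V :=
  if Q.oS c then pgSideHalfW G φ c (Q.nS c) (Q.hS c) (Q.ℓS c) (Q.RS c) e 1
  else if (Mz : ℤ) + 3 ≤ |Q.hS c| then pgSideHalfW G (trφ φ) c (Q.nS c) (Q.hS c) (Q.ℓS c) (Q.RS c) (e * sgnz (Q.hS c)) e
  else pgTopPieceW G (trφ φ) c (Q.nS c) (Q.hS c) (Q.ℓS c) (Q.RS c) e 1 (Q.vS c)

variable (G φ) in
/-- The piece of the level-side exit at `c` (`e = σ₀σ`, long data `(n_L, h_L)`, offset `A`). -/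
def pexLev (Q : ShortPcO V) (nL : ℕ) (hL A : ℤ) (e : ℤ) (c : V) : Finset V :=
  if Q.oS c then
    (if A + nL ≤ |(nL : ℤ) * Q.hS c - hL * Q.nS c| then
      pgSideHalfW G φ c (Q.nS c) (Q.hS c) (Q.ℓS c) (Q.RS c) (e * sgnz ((nL : ℤ) * Q.hS c - hL * Q.nS c)) e
    else pgTopPieceW G φ c (Q.nS c) (Q.hS c) (Q.ℓS c) (Q.RS c) e 1 (Q.vS c))
  else
    (if A + nL ≤ |(nL : ℤ) * Q.nS c - hL * Q.hS c| then
      pgSideHalfW G (trφ φ) c (Q.nS c) (Q.hS c) (Q.ℓS c) (Q.RS c) (e * sgnz ((nL : ℤ) * Q.nS c - hL * Q.hS c)) (-e * sgnz hL)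
    else pgTopPieceW G (trφ φ) c (Q.nS c) (Q.hS c) (Q.ℓS c) (Q.RS c) (-e * sgnz hL) 1 (Q.vS c))

variable (G φ) in
/-- **The exit table of an x-run level kit**: raw sides `i = 0`, level sides `i = 1`. -/
def pexXO (Q : ShortPcO V) (Mz nL : ℕ) (hL A σ : ℤ) (i : Fin 2) (σ₀ : ℤˣ) (c : V) : Finset V :=
  if i = 0 then pexRaw G φ Q Mz ((σ₀ : ℤ) * σ) c else pexLev G φ Q nL hL A ((σ₀ : ℤ) * σ) c

variable (G φ) in
/-- **The exit table of a y′-run level kit**: level sides `i = 0`, raw sides `i = 1`. -/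
def pexYO (Q : ShortPcO V) (Mz nL : ℕ) (hL A σ : ℤ) (i : Fin 2) (σ₀ : ℤˣ) (c : V) : Finset V :=
  if i = 0 then pexLev G φ Q nL hL A ((σ₀ : ℤ) * σ) c else pexRaw G φ Q Mz ((σ₀ : ℤ) * σ) c

/-! ## The pieces lie in the short prism -/

omit [G.LocallyFinite] in
/-- `oriφ` by cases. [folklore] -/
theorem oriφ_true_false (φ : V → Site 2) : oriφ φ true = φ ∧ oriφ φ false = trφ φ := ⟨rfl, rfl⟩

/-- The raw-side piece lies in the short prism. [folklore] -/
theorem pexRaw_subset (Q : ShortPcO V) (Mz : ℕ) (e : ℤ) (c : V) : pexRaw G φ Q Mz e c ⊆ RgO G φ Q c := by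
  intro v hv
  unfold RgO; unfold pexRaw at hv
  rw [mem_pgramPrismFin]
  cases hQ : Q.oS c
  · rw [hQ] at hv; simp only [Bool.false_eq_true, if_false] at hv
    rw [(oriφ_true_false φ).2]
    split_ifs at hv
    · exact ((mem_pgSideHalfW G (trφ φ)).1 hv).1
    · exact ((mem_pgTopPieceW G (trφ φ)).1 hv).1
  · rw [hQ] at hv; simp only [if_true] at hv
    rw [(oriφ_true_false φ).1]
    exact ((mem_pgSideHalfW G φ).1 hv).1

/-- The level-side piece lies in the short prism. [folklore] -/
theorem pexLev_subset (Q : ShortPcO V) (nL : ℕ) (hL A e : ℤ) (c : V) : pexLev G φ Q nL hL A e c ⊆ RgO G φ Q c := by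
  intro v hv
  unfold RgO; unfold pexLev at hv
  rw [mem_pgramPrismFin]
  cases hQ : Q.oS c
  · rw [hQ] at hv; simp only [Bool.false_eq_true, if_false] at hv
    rw [(oriφ_true_false φ).2]
    split_ifs at hv
    · exact ((mem_pgSideHalfW G (trφ φ)).1 hv).1
    · exact ((mem_pgTopPieceW G (trφ φ)).1 hv).1
  · rw [hQ] at hv; simp only [if_true] at hv
    rw [(oriφ_true_false φ).1]
    split_ifs at hv
    · exact ((mem_pgSideHalfW G φ).1 hv).1
    · exact ((mem_pgTopPieceW G φ).1 hv).1

/-- The x-table's pieces lie in the short prism. [folklore] -/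
theorem pexXO_subset (Q : ShortPcO V) (Mz nL : ℕ) (hL A σ : ℤ) (i : Fin 2) (σ₀ : ℤˣ) (c : V) :
    pexXO G φ Q Mz nL hL A σ i σ₀ c ⊆ RgO G φ Q c := by
  unfold pexXO; split_ifs
  · exact pexRaw_subset Q Mz _ c
  · exact pexLev_subset Q nL hL A _ c

/-- The y-table's pieces lie in the short prism. [folklore] -/
theorem pexYO_subset (Q : ShortPcO V) (Mz nL : ℕ) (hL A σ : ℤ) (i : Fin 2) (σ₀ : ℤˣ) (c : V) :
    pexYO G φ Q Mz nL hL A σ i σ₀ c ⊆ RgO G φ Q c := by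
  unfold pexYO; split_ifs
  · exact pexLev_subset Q nL hL A _ c
  · exact pexRaw_subset Q Mz _ c

/-- The short prism lies in the graph ball of its radius. [folklore] -/
theorem RgO_subset_graphBall (Q : ShortPcO V) (c : V) : ∀ u ∈ RgO G φ Q c, u ∈ graphBall G c (Q.RS c) := by
  intro u hu
  unfold RgO at hu
  rw [mem_pgramPrismFin] at hu
  exact pgramPrism_subset_graphBall (G := G) (φ := oriφ φ (Q.oS c)) c _ _ _ _ hu

/-! ## The exit quantities from the table -/

section Spec

variable {Q : ShortPcO V} {Mz nL : ℕ} {hL A : ℤ} {e : ℤ} {c v : V}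

/-- **Raw-side exit**: every vertex of `pexRaw` has `e·α_c ≥ M_z + 3`. [this work] -/
theorem pexRaw_goal (he : e = 1 ∨ e = -1) (hnS : 22 * Mz + 58 ≤ Q.nS c)
    (hℓ : 24 * Mz + 64 ≤ Q.ℓS c) (hv : v ∈ pexRaw G φ Q Mz e c) : (Mz : ℤ) + 3 ≤ e * relCoord φ c 0 v := by
  unfold pexRaw at hv
  have hnS1 : 1 ≤ Q.nS c := by omega
  cases hQ : Q.oS c
  · rw [hQ] at hv; simp only [Bool.false_eq_true, if_false] at hv
    split_ifs at hv with hh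
    · exact hh.trans (rawGoal_tr_half he hnS1 hv)
    · push Not at hh
      have h := rawGoal_tr_top he hv
      have ha := trTopRaw_arith (nS := Q.nS c) (ℓS := Q.ℓS c) (Mz := Mz) (hS := Q.hS c) (by omega) (by omega) (by omega)
      have hnS0 : (0 : ℤ) < Q.nS c := by exact_mod_cast hnS1
      exact le_of_mul_le_mul_left (by linarith) hnS0
  · rw [hQ] at hv; simp only [if_true] at hv
    rw [rawGoal_same_half he hv]; omega

/-- **Level-side exit**: every vertex of `pexLev` has `e·β′_{L,c} ≥ A + n_L`. [this work] -/
theorem pexLev_goal (he : e = 1 ∨ e = -1) (hnL : 1 ≤ nL) (hκL : |hL| ≤ 10 * (nL : ℤ)) (hnS : 22 * Mz + 58 ≤ Q.nS c)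
    (hκS : |Q.hS c| ≤ 10 * (Q.nS c : ℤ)) (hℓ : 24 * Mz + 64 ≤ Q.ℓS c) (hA : A = (Mz + 1 : ℕ) * ((nL : ℤ) + |hL|) + 1)
    (hv : v ∈ pexLev G φ Q nL hL A e c) : A + nL ≤ e * shearCoord φ c nL hL v := by
  unfold pexLev at hv
  have hnS1 : 1 ≤ Q.nS c := by omega
  have hnS0 : (0 : ℤ) < Q.nS c := by exact_mod_cast hnS1
  cases hQ : Q.oS c
  · rw [hQ] at hv; simp only [Bool.false_eq_true, if_false] at hv
    split_ifs at hv with hX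
    · exact hX.trans (levGoal_tr_half he hnS1 hv)
    · push Not at hX
      have h := levGoal_tr_top (nL := nL) he hv
      have ha := trTop_arith hnL hnS hκS hℓ hA hX
      refine le_of_mul_le_mul_left ?_ hnS0
      have hX' := mul_le_mul_of_nonneg_left hX.le hnS0.le
      nlinarith [h, ha, hX', abs_nonneg ((nL : ℤ) * Q.nS c - hL * Q.hS c), abs_nonneg hL]
  · rw [hQ] at hv; simp only [if_true] at hv
    split_ifs at hv with hE
    · exact hE.trans (levGoal_same_half he hnS1 hv)
    · push Not at hE
      have h := levGoal_same_top (nL := nL) (hL := hL) he hv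
      have ha := sameTop_arith hnL hnS1 hκS hκL (show 22 * Mz + 57 ≤ Q.ℓS c by omega) hA
      refine le_of_mul_le_mul_left ?_ hnS0
      have hE' := mul_le_mul_of_nonneg_left hE.le hnS0.le
      have hnL0 : (0 : ℤ) ≤ nL := by positivity
      nlinarith [h, ha, hE', abs_nonneg ((nL : ℤ) * Q.hS c - hL * Q.nS c)]

end Spec

/-! ## From the exit quantities to the placement below the shell line -/

omit [G.LocallyFinite] in
/-- **Raw side form: placement from `e·α ≥ M_z + 3`** (`A = (M_z+1)U + 1`). [this work] -/
theorem rawSideU_place {ψ : V → Site 2} (c₀ : V) (σ : ℤ) (hσ : σ = 1 ∨ σ = -1) {U : ℤ} (hU : 1 ≤ U) (Lo Hi : Site 2) (i : Fin 2) (σ₀ : ℤˣ)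
    (hraw : ∀ w, ψ w i = σ * (φ w 0 - φ c₀ 0)) {A : ℤ} {Mz : ℕ} (hA : A = (Mz + 1 : ℕ) * U + 1) {c v : V}
    (hg : (Mz : ℤ) + 3 ≤ (σ₀ : ℤ) * σ * relCoord φ c 0 v) :
    (rawSideU ψ c₀ σ hσ hU Lo Hi i σ₀ hraw).lin (φ v) + A +
        ((rawSideU ψ c₀ σ hσ hU Lo Hi i σ₀ hraw).s : ℤ) * coef (rawSideU ψ c₀ σ hσ hU Lo Hi i σ₀ hraw).cα
          (rawSideU ψ c₀ σ hσ hU Lo Hi i σ₀ hraw).cβ (rawSideU ψ c₀ σ hσ hU Lo Hi i σ₀ hraw).a ≤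
      (rawSideU ψ c₀ σ hσ hU Lo Hi i σ₀ hraw).lin (φ c) := by
  rw [(rawSideU_isAffine c₀ σ hσ hU Lo Hi i σ₀ hraw).clim_eq]
  have hd : (rawSideU ψ c₀ σ hσ hU Lo Hi i σ₀ hraw).lin (φ v) - (rawSideU ψ c₀ σ hσ hU Lo Hi i σ₀ hraw).lin (φ c) =
      -((σ₀ : ℤ) * σ) * U * relCoord φ c 0 v := by
    simp only [SideForm.lin, rawSideU, linForm, relCoord_apply]; ring
  rw [hA]; push_cast
  have h1 : ((Mz : ℤ) + 3) * U ≤ ((σ₀ : ℤ) * σ * relCoord φ c 0 v) * U := mul_le_mul_of_nonneg_right hg (by linarith)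
  nlinarith [hd, h1]

omit [G.LocallyFinite] in
/-- **Level side form: placement from `e·β′ ≥ A + n`.** [this work] -/
theorem levSide_place {ψ : V → Site 2} (c₀ : V) {n : ℕ} (hn : 1 ≤ n) (h σ : ℤ) (hσ : σ = 1 ∨ σ = -1) (Lo Hi : Site 2) (i : Fin 2) (σ₀ : ℤˣ)
    (hlev : ∀ w, ψ w i = (σ * shearCoord φ c₀ n h w) / (shearUnit n h : ℤ)) {A : ℤ} {c v : V}
    (hg : A + n ≤ (σ₀ : ℤ) * σ * shearCoord φ c n h v) :
    (levSide ψ c₀ hn h σ hσ Lo Hi i σ₀ hlev).lin (φ v) + A +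
        ((levSide ψ c₀ hn h σ hσ Lo Hi i σ₀ hlev).s : ℤ) * coef (levSide ψ c₀ hn h σ hσ Lo Hi i σ₀ hlev).cα
          (levSide ψ c₀ hn h σ hσ Lo Hi i σ₀ hlev).cβ (levSide ψ c₀ hn h σ hσ Lo Hi i σ₀ hlev).a ≤
      (levSide ψ c₀ hn h σ hσ Lo Hi i σ₀ hlev).lin (φ c) := by
  rw [levSide_C]
  have hd := levSide_lin_sub (φ := φ) c₀ hn h σ hσ Lo Hi i σ₀ hlev c v
  linarith

/-! ## The `hPex` hypothesis of the run-level kit clauses -/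

/-- **The x-table satisfies `hPex` for the x-run side forms** under the ledger floors. [this work] -/
theorem pexXO_spec (c₀ : V) {nL : ℕ} (hnL : 1 ≤ nL) (hL : ℤ) {σ : ℤ} (hσ : σ = 1 ∨ σ = -1) (hκL : |hL| ≤ 10 * (nL : ℤ)) (Lo Hi : Site 2)
    (Q : ShortPcO V) {A : ℤ} {Mz : ℕ} (hA : A = (Mz + 1 : ℕ) * (shearUnit nL hL : ℤ) + 1)
    (hnS : ∀ c, 22 * Mz + 58 ≤ Q.nS c) (hκS : ∀ c, |Q.hS c| ≤ 10 * (Q.nS c : ℤ)) (hℓ : ∀ c, 24 * Mz + 64 ≤ Q.ℓS c)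
    (i : Fin 2) (σ₀ : ℤˣ) (c : V) : ∀ v ∈ pexXO G φ Q Mz nL hL A σ i σ₀ c, v ∈ RgO G φ Q c ∧
      (runXSideU (φ := φ) c₀ hnL hL hσ Lo Hi i σ₀).lin (φ v) + A +
        ((runXSideU (φ := φ) c₀ hnL hL hσ Lo Hi i σ₀).s : ℤ) * coef (runXSideU (φ := φ) c₀ hnL hL hσ Lo Hi i σ₀).cα
          (runXSideU (φ := φ) c₀ hnL hL hσ Lo Hi i σ₀).cβ (runXSideU (φ := φ) c₀ hnL hL hσ Lo Hi i σ₀).a ≤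
      (runXSideU (φ := φ) c₀ hnL hL hσ Lo Hi i σ₀).lin (φ c) := by
  intro v hv
  refine ⟨pexXO_subset Q Mz nL hL A σ i σ₀ c hv, ?_⟩
  have hU1 : (1 : ℤ) ≤ (shearUnit nL hL : ℤ) := by have := shearUnit_pos hnL hL; omega
  have hUeq : ((shearUnit nL hL : ℕ) : ℤ) = nL + |hL| := by unfold shearUnit; push_cast; rfl
  have hA' : A = (Mz + 1 : ℕ) * ((nL : ℤ) + |hL|) + 1 := by rw [hA, hUeq]
  have he : (σ₀ : ℤ) * σ = 1 ∨ (σ₀ : ℤ) * σ = -1 := by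
    rcases Int.units_eq_one_or σ₀ with h | h <;> rcases hσ with h' | h' <;> simp [h, h']
  unfold pexXO at hv
  fin_cases i <;> simp only [Fin.zero_eta, Fin.isValue, Fin.mk_one, if_true, show ¬ ((1 : Fin 2) = 0) by decide, if_false] at hv ⊢
  · exact rawSideU_place (ψ := runX φ c₀ nL hL σ) c₀ σ hσ hU1 Lo Hi 0 σ₀ (fun w => by rw [runX_zero, relCoord_apply]) hA
      (pexRaw_goal he (hnS c) (hℓ c) hv)
  · exact levSide_place (ψ := runX φ c₀ nL hL σ) c₀ hnL hL σ hσ Lo Hi 1 σ₀ (fun w => by rw [runX_one])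
      (pexLev_goal he hnL hκL (hnS c) (hκS c) (hℓ c) hA' hv)

/-- **The y-table satisfies `hPex` for the y′-run side forms** under the ledger floors. [this work] -/
theorem pexYO_spec (c₀ : V) {nL : ℕ} (hnL : 1 ≤ nL) (hL : ℤ) {σ : ℤ} (hσ : σ = 1 ∨ σ = -1) (hκL : |hL| ≤ 10 * (nL : ℤ)) (Lo Hi : Site 2)
    (Q : ShortPcO V) {A : ℤ} {Mz : ℕ} (hA : A = (Mz + 1 : ℕ) * (shearUnit nL hL : ℤ) + 1)
    (hnS : ∀ c, 22 * Mz + 58 ≤ Q.nS c) (hκS : ∀ c, |Q.hS c| ≤ 10 * (Q.nS c : ℤ)) (hℓ : ∀ c, 24 * Mz + 64 ≤ Q.ℓS c)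
    (i : Fin 2) (σ₀ : ℤˣ) (c : V) : ∀ v ∈ pexYO G φ Q Mz nL hL A σ i σ₀ c, v ∈ RgO G φ Q c ∧
      (runYSideU (φ := φ) c₀ hnL hL hσ Lo Hi i σ₀).lin (φ v) + A +
        ((runYSideU (φ := φ) c₀ hnL hL hσ Lo Hi i σ₀).s : ℤ) * coef (runYSideU (φ := φ) c₀ hnL hL hσ Lo Hi i σ₀).cα
          (runYSideU (φ := φ) c₀ hnL hL hσ Lo Hi i σ₀).cβ (runYSideU (φ := φ) c₀ hnL hL hσ Lo Hi i σ₀).a ≤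
      (runYSideU (φ := φ) c₀ hnL hL hσ Lo Hi i σ₀).lin (φ c) := by
  intro v hv
  refine ⟨pexYO_subset Q Mz nL hL A σ i σ₀ c hv, ?_⟩
  have hU1 : (1 : ℤ) ≤ (shearUnit nL hL : ℤ) := by have := shearUnit_pos hnL hL; omega
  have hUeq : ((shearUnit nL hL : ℕ) : ℤ) = nL + |hL| := by unfold shearUnit; push_cast; rfl
  have hA' : A = (Mz + 1 : ℕ) * ((nL : ℤ) + |hL|) + 1 := by rw [hA, hUeq]
  have he : (σ₀ : ℤ) * σ = 1 ∨ (σ₀ : ℤ) * σ = -1 := by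
    rcases Int.units_eq_one_or σ₀ with h | h <;> rcases hσ with h' | h' <;> simp [h, h']
  unfold pexYO at hv
  fin_cases i <;> simp only [Fin.zero_eta, Fin.isValue, Fin.mk_one, if_true, show ¬ ((1 : Fin 2) = 0) by decide, if_false] at hv ⊢
  · exact levSide_place (ψ := runY φ c₀ nL hL σ) c₀ hnL hL σ hσ Lo Hi 0 σ₀ (fun w => by rw [runY_zero])
      (pexLev_goal he hnL hκL (hnS c) (hκS c) (hℓ c) hA' hv)
  · exact rawSideU_place (ψ := runY φ c₀ nL hL σ) c₀ σ hσ hU1 Lo Hi 1 σ₀ (fun w => by rw [runY_one, relCoord_apply]) hA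
      (pexRaw_goal he (hnS c) (hℓ c) hv)

end Skelφ

end Summit.CriticalPhenomena.PercolationContinuityZ3.Theorems.Transplant

end
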